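import Mathlib
import Literature.NumberTheory.MahlerMeasure.MinimalMeasuresByDegree
import Literature.NumberTheory.MahlerMeasure.NonreciprocalBound
import Summits.Ventures.DiscreteObjects.Mahler.SubLehmerDegree56

/-!
# Sub-Lehmer polynomials at degree 57 reduce to degree 56 (venture `DiscreteObjects`, target L, family L6)

Cell `pub-namedobj`, seat `pub-namedobj-mahler` (gen 4). Framing: lottery ticket; floor = certified
bounds/negative ranges.

Continuation of `SubLehmerDegree56.lean`.  Conditional on the named facts
`Literature.NumberTheory.MahlerMeasure.SubLehmerDegreeBound` ([MRW08, Thm 1.1]: sub-Lehmer ⇒ degree `≥ 56`)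
and `Literature.NumberTheory.MahlerMeasure.NonreciprocalMahlerBound` (Smyth), a sub-Lehmer integer
polynomial of degree `57` is `x·Q`, `(x+1)·Q` or `(x-1)·Q` with `Q` sub-Lehmer of degree `56`
(`subLehmer_degree57_structure`).  For the cell's height-1 census this is the statement that degree 57
costs exactly ONE extra enumeration beyond the degree-56 slice: the "offset" family `P = (x+1)·Q`
(power-sum box `|s_k(P) - s_k(x+1)| ≤ T_k(56)`), `(x-1)·Q` being its image under `x ↦ -x` and `x·Q` the
degree-56 slice itself (EFFICIENCY-L6.md, CONTROLS-L6.md §3c).  General lemmas on the way: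
`natDegree_le_of_dvd_of_measure_one` (a measure-1 factor of a sub-Lehmer polynomial has degree
`≤ deg P - 56`), `measure_one_of_mul` (in a factorisation of a sub-Lehmer polynomial of degree `< 112`
one factor has measure `1`), `eval_neg_one_eq_zero_of_reverse_eq` / `eval_one_eq_zero_of_reverse_eq_neg`
((anti)palindromic ⇒ root at `∓1`), `linear_of_measure_one`.
-/

namespace Summit.Ventures.DiscreteObjects.Mahler

open Polynomial Literature.NumberTheory.MahlerMeasure


/-- In a sub-Lehmer integer polynomial, a factor of Mahler measure `1` has degree at most `deg P - 56`
(its cofactor is sub-Lehmer, hence of degree `≥ 56` by [MRW08, Thm 1.1]). -/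
theorem natDegree_le_of_dvd_of_measure_one (h : SubLehmerDegreeBound) {P R : ℤ[X]} (hP : SubLehmer P)
    (hR : R ∣ P) (hMR : intMahlerMeasure R = 1) : R.natDegree + 56 ≤ P.natDegree := by
  obtain ⟨Q, rfl⟩ := hR
  have hP0 : R * Q ≠ 0 := by
    intro h0
    have := hP.1
    rw [h0] at this
    unfold intMahlerMeasure at this
    simp only [Polynomial.map_zero, mahlerMeasure_zero] at this
    linarith
  have hR0 : R ≠ 0 := left_ne_zero_of_mul hP0
  have hQ0 : Q ≠ 0 := right_ne_zero_of_mul hP0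
  have hMQ : intMahlerMeasure Q = intMahlerMeasure (R * Q) := by
    rw [intMahlerMeasure_mul, hMR, one_mul]
  have hQsub : SubLehmer Q := by
    unfold SubLehmer at hP ⊢; rw [hMQ]; exact hP
  have hQdeg : 56 ≤ Q.natDegree := natDegree_ge_of_subLehmer h hQsub
  rw [natDegree_mul hR0 hQ0]
  omega

/-- In a factorisation `P = a * b` of a sub-Lehmer polynomial of degree `< 112`, one factor has Mahler
measure exactly `1` (two factors of measure `> 1` would each be sub-Lehmer of degree `≥ 56`, or push
`M(P) ≥ M(L)`). -/
theorem measure_one_of_mul (h : SubLehmerDegreeBound) {P a b : ℤ[X]} (hP : SubLehmer P) (hab : P = a * b)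
    (hdeg : P.natDegree < 112) : intMahlerMeasure a = 1 ∨ intMahlerMeasure b = 1 := by
  have hP0 : P ≠ 0 := by
    intro h0; have := hP.1; rw [h0] at this; unfold intMahlerMeasure at this
    simp only [Polynomial.map_zero, mahlerMeasure_zero] at this; linarith
  have ha0 : a ≠ 0 := by intro h0; apply hP0; rw [hab, h0, zero_mul]
  have hb0 : b ≠ 0 := by intro h0; apply hP0; rw [hab, h0, mul_zero]
  have ha1 : 1 ≤ intMahlerMeasure a := one_le_intMahlerMeasure ha0
  have hb1 : 1 ≤ intMahlerMeasure b := one_le_intMahlerMeasure hb0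
  have hL0 : 0 ≤ intMahlerMeasure lehmerPoly := le_of_lt (lt_trans (by norm_num) lehmer_measure_lower_bound)
  have hMab : intMahlerMeasure P = intMahlerMeasure a * intMahlerMeasure b := by rw [hab, intMahlerMeasure_mul]
  by_contra hne
  push Not at hne
  have ha1' : 1 < intMahlerMeasure a := lt_of_le_of_ne ha1 (Ne.symm hne.1)
  have hb1' : 1 < intMahlerMeasure b := lt_of_le_of_ne hb1 (Ne.symm hne.2)
  -- neither factor can have measure ≥ M(L)
  have haL : intMahlerMeasure a < intMahlerMeasure lehmerPoly := by
    by_contra hge; rw [not_lt] at hge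
    have : intMahlerMeasure lehmerPoly ≤ intMahlerMeasure P := by
      rw [hMab]
      calc intMahlerMeasure lehmerPoly = intMahlerMeasure lehmerPoly * 1 := (mul_one _).symm
        _ ≤ intMahlerMeasure a * intMahlerMeasure b := mul_le_mul hge hb1 (by norm_num) (le_trans (by norm_num) ha1)
    linarith [hP.2]
  have hbL : intMahlerMeasure b < intMahlerMeasure lehmerPoly := by
    by_contra hge; rw [not_lt] at hge
    have : intMahlerMeasure lehmerPoly ≤ intMahlerMeasure P := by
      rw [hMab]
      calc intMahlerMeasure lehmerPoly = 1 * intMahlerMeasure lehmerPoly := (one_mul _).symm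
        _ ≤ intMahlerMeasure a * intMahlerMeasure b := mul_le_mul ha1 hge hL0 (le_trans (by norm_num) ha1)
    linarith [hP.2]
  have hda : 56 ≤ a.natDegree := natDegree_ge_of_subLehmer h ⟨ha1', haL⟩
  have hdb : 56 ≤ b.natDegree := natDegree_ge_of_subLehmer h ⟨hb1', hbL⟩
  have : P.natDegree = a.natDegree + b.natDegree := by rw [hab, natDegree_mul ha0 hb0]
  omega

/-- A palindromic (`reverse P = P`) integer polynomial of odd degree vanishes at `-1`. -/
theorem eval_neg_one_eq_zero_of_reverse_eq {P : ℤ[X]} (hrev : P.reverse = P) (hodd : Odd P.natDegree) :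
    P.eval (-1) = 0 := by
  letI : Invertible (1 : ℤ) := invertibleOne
  letI : Invertible (-1 : ℤ) := invertibleNeg 1
  have h := eval₂_reverse_mul_pow (RingHom.id ℤ) (-1 : ℤ) P
  rw [hrev] at h
  have hinv : (⅟(-1 : ℤ)) = -1 := by
    have hm := invOf_mul_self (-1 : ℤ)
    linarith
  rw [hinv, eval₂_id, Odd.neg_one_pow hodd] at h
  -- h : eval (-1) P * (-1) = eval (-1) P
  linarith

/-- An antipalindromic (`reverse P = -P`) integer polynomial vanishes at `1`. -/
theorem eval_one_eq_zero_of_reverse_eq_neg {P : ℤ[X]} (hrev : P.reverse = -P) : P.eval 1 = 0 := by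
  letI : Invertible (1 : ℤ) := invertibleOne
  have h := eval₂_reverse_mul_pow (RingHom.id ℤ) (1 : ℤ) P
  rw [hrev] at h
  have hinv : (⅟(1 : ℤ)) = 1 := by
    have hm := invOf_mul_self (1 : ℤ)
    linarith
  rw [hinv] at h
  simp only [eval₂_id, one_pow, mul_one, eval_neg] at h
  linarith

/-- An integer polynomial of degree `1` and Mahler measure `1` is `± (X + v)` with `v ∈ {-1, 0, 1}`:
precisely, its leading coefficient `l` and constant term `v` satisfy `|l| = 1` and `|v| ≤ 1`. -/
theorem linear_of_measure_one {b : ℤ[X]} (hdeg : b.natDegree = 1) (hM : intMahlerMeasure b = 1) :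
    |b.coeff 1| = 1 ∧ |b.coeff 0| ≤ 1 := by
  have hb0 : b ≠ 0 := by intro h0; rw [h0, natDegree_zero] at hdeg; exact absurd hdeg (by norm_num)
  have hlc : b.leadingCoeff = b.coeff 1 := by rw [leadingCoeff, hdeg]
  -- |leading coefficient| ≤ M(b) = 1 and every coefficient is bounded by C(1,k)·M(b)
  have h1 : ‖(b.map (Int.castRingHom ℂ)).leadingCoeff‖ ≤ (b.map (Int.castRingHom ℂ)).mahlerMeasure :=
    leadingCoeff_le_mahlerMeasure _
  rw [leadingCoeff_map_of_injective (Int.castRingHom ℂ).injective_int, hlc] at h1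
  have h0c : ‖(b.map (Int.castRingHom ℂ)).coeff 0‖ ≤
      ((b.map (Int.castRingHom ℂ)).natDegree.choose 0 : ℝ) * (b.map (Int.castRingHom ℂ)).mahlerMeasure :=
    norm_coeff_le_choose_mul_mahlerMeasure 0 _
  rw [natDegree_map_eq_of_injective (Int.castRingHom ℂ).injective_int, coeff_map] at h0c
  change ‖((Int.castRingHom ℂ) (b.coeff 1))‖ ≤ intMahlerMeasure b at h1
  change ‖((Int.castRingHom ℂ) (b.coeff 0))‖ ≤ (b.natDegree.choose 0 : ℝ) * intMahlerMeasure b at h0c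
  rw [hM] at h1 h0c
  rw [hdeg] at h0c
  simp only [eq_intCast, Complex.norm_intCast, Nat.choose_zero_right, Nat.cast_one, one_mul] at h1 h0c
  have hl0 : b.coeff 1 ≠ 0 := by rw [← hlc]; exact leadingCoeff_ne_zero.mpr hb0
  have hl1 : (1 : ℤ) ≤ |b.coeff 1| := Int.one_le_abs hl0
  constructor
  · have : (|b.coeff 1| : ℝ) ≤ 1 := by exact_mod_cast h1
    have : |b.coeff 1| ≤ 1 := by exact_mod_cast this
    omega
  · have : (|b.coeff 0| : ℝ) ≤ 1 := by exact_mod_cast h0c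
    exact_mod_cast this

/-- **Degree 57 reduces to degree 56** (kernel; conditional on [MRW08, Thm 1.1] and Smyth's theorem as
named facts): a sub-Lehmer integer polynomial of degree `57` is `x·Q`, `(x+1)·Q` or `(x-1)·Q` with `Q`
sub-Lehmer of degree `56` (so `Q` falls under the degree-56 analysis above: irreducible, cyclotomic-free,
reciprocal).  For the height-1 census this says: degree 57 = the degree-56 slice (`x·Q`) plus ONE offset
family (`(x+1)·Q`; `(x-1)·Q` is its image under `x ↦ -x`), cf. EFFICIENCY-L6.md. -/
theorem subLehmer_degree57_structure (h : SubLehmerDegreeBound) (hS : NonreciprocalMahlerBound) {P : ℤ[X]}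
    (hdeg : P.natDegree = 57) (hP : SubLehmer P) :
    ∃ Q : ℤ[X], Q.natDegree = 56 ∧ SubLehmer Q ∧ (P = X * Q ∨ P = (X + 1) * Q ∨ P = (X - 1) * Q) := by
  have hP0 : P ≠ 0 := by
    intro h0; rw [h0, natDegree_zero] at hdeg; exact absurd hdeg (by norm_num)
  have hLup : intMahlerMeasure lehmerPoly < 117629 / 100000 := lehmer_measure_upper_bound
  -- Step 1: P is not irreducible (an irreducible P would be (anti)reciprocal of odd degree, hence divisible by x ± 1).
  have hnotirr : ¬ Irreducible P := by
    intro hirr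
    -- x ∤ P: otherwise P is associated to X, of degree 1
    have hc0 : P.coeff 0 ≠ 0 := by
      intro h0
      have hXd : X ∣ P := X_dvd_iff.mpr h0
      obtain ⟨R, hR⟩ := hXd
      rcases hirr.isUnit_or_isUnit hR with hu | hu
      · exact absurd (natDegree_eq_zero_of_isUnit hu) (by rw [natDegree_X]; norm_num)
      · have := natDegree_eq_zero_of_isUnit hu
        have h2 : P.natDegree = 1 := by
          rw [hR, natDegree_mul X_ne_zero (by rintro rfl; simp at hR; exact hP0 hR), natDegree_X, this]
        omega
    -- reciprocal or antireciprocal by Smyth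
    have hrev : P.reverse = P ∨ P.reverse = -P := by
      by_contra hnot
      push Not at hnot
      have hsm := hS P hirr hc0 hnot.1 hnot.2
      have h1 := smythPoly_measure_lower_bound
      change intMahlerMeasure (X ^ 3 - X - 1 : ℤ[X]) ≤ intMahlerMeasure P at hsm
      linarith [hP.2]
    have hodd : Odd P.natDegree := by rw [hdeg]; decide
    -- a linear factor x ± 1 divides P
    have hlin : (X - C (-1 : ℤ)) ∣ P ∨ (X - C (1 : ℤ)) ∣ P := by
      rcases hrev with hr | hr
      · left; exact dvd_iff_isRoot.mpr (eval_neg_one_eq_zero_of_reverse_eq hr hodd)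
      · right; exact dvd_iff_isRoot.mpr (eval_one_eq_zero_of_reverse_eq_neg hr)
    have key : ∀ c : ℤ, (X - C c) ∣ P → False := by
      intro c hdvd
      obtain ⟨R, hR⟩ := hdvd
      have hXc0 : (X - C c : ℤ[X]) ≠ 0 := X_sub_C_ne_zero c
      rcases hirr.isUnit_or_isUnit hR with hu | hu
      · exact absurd (natDegree_eq_zero_of_isUnit hu) (by rw [natDegree_X_sub_C]; norm_num)
      · have h0 := natDegree_eq_zero_of_isUnit hu
        have hR0 : R ≠ 0 := by rintro rfl; rw [mul_zero] at hR; exact hP0 hR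
        have h2 : P.natDegree = 1 := by rw [hR, natDegree_mul hXc0 hR0, natDegree_X_sub_C, h0]
        omega
    rcases hlin with hl | hl
    · exact key (-1) hl
    · exact key 1 hl
  -- Step 2: a nontrivial factorisation P = a * b; one factor has measure 1 and then degree ≤ 1.
  have hnu : ¬ IsUnit P := fun hu => by have := natDegree_eq_zero_of_isUnit hu; omega
  obtain ⟨a, b, hab, hna, hnb⟩ : ∃ a b : ℤ[X], P = a * b ∧ ¬ IsUnit a ∧ ¬ IsUnit b := by
    by_contra hnone
    push Not at hnone
    exact hnotirr ⟨hnu, fun a b hab => by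
      by_cases ha : IsUnit a
      · exact Or.inl ha
      · exact Or.inr (hnone a b hab ha)⟩
  have ha0 : a ≠ 0 := by intro h0; apply hP0; rw [hab, h0, zero_mul]
  have hb0 : b ≠ 0 := by intro h0; apply hP0; rw [hab, h0, mul_zero]
  -- arrange that b is the measure-1 factor
  wlog hMb : intMahlerMeasure b = 1 generalizing a b
  · have hor := measure_one_of_mul h hP hab (by omega)
    have hMa : intMahlerMeasure a = 1 := by tauto
    exact this b a (by rw [hab, mul_comm]) hnb hna hb0 ha0 hMa
  have hbdeg : b.natDegree + 56 ≤ P.natDegree :=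
    natDegree_le_of_dvd_of_measure_one h hP (Dvd.intro_left a hab.symm) hMb
  have hbd1 : b.natDegree ≤ 1 := by omega
  -- degree 0 would make b a unit (|constant| = M(b) = 1)
  have hbd : b.natDegree = 1 := by
    rcases Nat.lt_or_ge b.natDegree 1 with hlt | hge
    · exfalso
      have h0 : b.natDegree = 0 := by omega
      rw [eq_C_of_natDegree_eq_zero h0] at hMb hnb
      rw [intMahlerMeasure_C] at hMb
      apply hnb
      apply isUnit_C.mpr
      rw [Int.isUnit_iff_abs_eq]
      exact_mod_cast hMb
    · omega
  obtain ⟨hl, hv⟩ := linear_of_measure_one hbd hMb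
  -- a has degree 56 and the same measure as P
  have hadeg : a.natDegree = 56 := by
    have : P.natDegree = a.natDegree + b.natDegree := by rw [hab, natDegree_mul ha0 hb0]
    omega
  have hMa : intMahlerMeasure a = intMahlerMeasure P := by
    rw [hab, intMahlerMeasure_mul, hMb, mul_one]
  -- write b = l·X + v with l = b.coeff 1 = ±1, v = b.coeff 0, |v| ≤ 1, and normalise the sign into Q := C l * a
  have hbform : b = C (b.coeff 1) * X + C (b.coeff 0) := by
    ext k
    simp only [coeff_add, coeff_C_mul, coeff_X, coeff_C]
    rcases k with _ | _ | k
    · simp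
    · simp
    · have : b.coeff (k + 2) = 0 := coeff_eq_zero_of_natDegree_lt (by omega)
      simp [this]
  have hl2 : b.coeff 1 * b.coeff 1 = 1 := by
    rcases (abs_eq (by norm_num : (0:ℤ) ≤ 1)).mp hl with h1 | h1 <;> rw [h1] <;> norm_num
  have hCl0 : C (b.coeff 1) ≠ (0 : ℤ[X]) := by
    intro h0; rw [C_eq_zero] at h0; rw [h0] at hl2; norm_num at hl2
  refine ⟨C (b.coeff 1) * a, ?_, ?_, ?_⟩
  · rw [natDegree_mul hCl0 ha0, natDegree_C, zero_add, hadeg]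
  · unfold SubLehmer
    rw [intMahlerMeasure_mul, intMahlerMeasure_C]
    have : |((b.coeff 1 : ℤ) : ℝ)| = 1 := by exact_mod_cast hl
    rw [this, one_mul, hMa]
    exact hP
  · -- P = a * (l X + v) = (l a) * (X + l v) since l² = 1; and l v ∈ {-1, 0, 1}
    have hPform : P = C (b.coeff 1) * a * (X + C (b.coeff 1 * b.coeff 0)) := by
      have : C (b.coeff 1) * a * (X + C (b.coeff 1 * b.coeff 0)) =
          a * (C (b.coeff 1) * X + C (b.coeff 1 * b.coeff 1 * b.coeff 0)) := by
        simp only [map_mul]; ring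
      rw [this, hl2, one_mul, ← hbform, hab]
    have hlv : b.coeff 1 * b.coeff 0 = 0 ∨ b.coeff 1 * b.coeff 0 = 1 ∨ b.coeff 1 * b.coeff 0 = -1 := by
      have : |b.coeff 1 * b.coeff 0| ≤ 1 := by rw [abs_mul, hl, one_mul]; exact hv
      rcases (abs_le.mp this) with ⟨h1, h2⟩
      omega
    rcases hlv with h0 | h1 | hm1
    · left; rw [hPform, h0, map_zero, add_zero, mul_comm]
    · right; left; rw [hPform, h1, map_one, mul_comm]
    · right; right; rw [hPform, hm1, map_neg, map_one, ← sub_eq_add_neg, mul_comm]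

end Summit.Ventures.DiscreteObjects.Mahler
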